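import Mathlib.Topology.Order.IntermediateValue
import Mathlib.Topology.Instances.Real.Lemmas
import Mathlib.Order.ConditionallyCompleteLattice.Indexed
import Mathlib.Topology.Order.Compact
import Mathlib.Topology.ContinuousOn
import Mathlib.Order.ConditionallyCompleteLattice.Basic
import HarnessLib

/-!
# First / last hitting parameters as `sInf` / `sSup`: attainment lemmas

Support file for item `stmt-CriticalPhenomena-18057` (`AttachNoReturn`, route `SAWReversalUpgrade`,
sub-problem `SAWScalingLimit`). The canonical boundary attachment of the route is written with six
real parameters defined as suprema / infima of hitting sets of continuous maps:

* `i₁ = sSup ({0} ∪ {u ∈ [0,1] | R u = a})` (last visit of `a` by the polyline `R`),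
* `j₁ = sInf ({1} ∪ {u ∈ [0,1] | R u = b})` (first visit of `b`),
* `s₁ = sInf {s ∈ (0,1] | f s ∈ M}` (first entrance of the access segment into the compact `M`),
* `r₁ = sSup ({1} ∪ {ρ ≥ 1 | g ρ ∈ M})` (last exit of the ray from `M`),
* `u₁ = sInf {u ∈ [i,j] | Z u = J}`, `v₁ = sSup {u ∈ [i,j] | Z u = J}` (first / last hit of a point).

This file records, once, the elementary real-variable facts "the extremum is attained and nothing is
hit beyond it" for each shape (closed bounded nonempty subsets of `ℝ` contain their `sSup`/`sInf`).
All statements are abstract (any `T1` target space); no lattice or conformal input.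
-/

namespace Summit.CriticalPhenomena.SAWScalingLimit.Theorems.AttachNoReturn

open Set Function Topology

section Order

variable {X : Type*} [TopologicalSpace X] [T1Space X]

/-- **Last visit of a point on `[0,1]`.** For `R` continuous and
`i = sSup ({0} ∪ {u ∈ [0,1] | R u = a})`: `i ∈ [0,1]`, either `R i = a` or `i = 0`, and `R u ≠ a`
for `i < u ≤ 1`. -/
theorem lastVisit_spec {R : ℝ → X} (hR : Continuous R) (a : X) {i : ℝ}
    (hi : i = sSup ({(0 : ℝ)} ∪ {u | u ∈ Icc (0 : ℝ) 1 ∧ R u = a})) :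
    i ∈ Icc (0 : ℝ) 1 ∧ (R i = a ∨ i = 0) ∧ ∀ u, i < u → u ≤ 1 → R u ≠ a := by
  set T : Set ℝ := {(0 : ℝ)} ∪ {u | u ∈ Icc (0 : ℝ) 1 ∧ R u = a} with hT
  have hTsub : T ⊆ Icc (0 : ℝ) 1 := by
    rintro u (hu | hu)
    · rw [mem_singleton_iff] at hu; subst hu; exact ⟨le_rfl, zero_le_one⟩
    · exact hu.1
  have hTne : T.Nonempty := ⟨0, Or.inl rfl⟩
  have hTcl : IsClosed T := by
    refine isClosed_singleton.union ?_
    change IsClosed (Icc (0 : ℝ) 1 ∩ R ⁻¹' {a})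
    exact isClosed_Icc.inter (isClosed_singleton.preimage hR)
  have hTbdd : BddAbove T := ⟨1, fun u hu => (hTsub hu).2⟩
  have hiT : i ∈ T := hi ▸ hTcl.csSup_mem hTne hTbdd
  refine ⟨hTsub hiT, ?_, ?_⟩
  · rcases hiT with h | h
    · exact Or.inr h
    · exact Or.inl h.2
  · intro u hiu hu1 hRu
    have hu0 : 0 ≤ u := ((hTsub hiT).1.trans hiu.le)
    have huT : u ∈ T := Or.inr ⟨⟨hu0, hu1⟩, hRu⟩
    have : u ≤ i := hi ▸ le_csSup hTbdd huT
    exact (lt_irrefl _) (hiu.trans_le this)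

/-- **First visit of a point on `[0,1]`.** For `R` continuous and
`j = sInf ({1} ∪ {u ∈ [0,1] | R u = b})`: `j ∈ [0,1]`, either `R j = b` or `j = 1`, and `R u ≠ b`
for `0 ≤ u < j`. -/
theorem firstVisit_spec {R : ℝ → X} (hR : Continuous R) (b : X) {j : ℝ}
    (hj : j = sInf ({(1 : ℝ)} ∪ {u | u ∈ Icc (0 : ℝ) 1 ∧ R u = b})) :
    j ∈ Icc (0 : ℝ) 1 ∧ (R j = b ∨ j = 1) ∧ ∀ u, 0 ≤ u → u < j → R u ≠ b := by
  set T : Set ℝ := {(1 : ℝ)} ∪ {u | u ∈ Icc (0 : ℝ) 1 ∧ R u = b} with hT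
  have hTsub : T ⊆ Icc (0 : ℝ) 1 := by
    rintro u (hu | hu)
    · rw [mem_singleton_iff] at hu; subst hu; exact ⟨zero_le_one, le_rfl⟩
    · exact hu.1
  have hTne : T.Nonempty := ⟨1, Or.inl rfl⟩
  have hTcl : IsClosed T := by
    refine isClosed_singleton.union ?_
    change IsClosed (Icc (0 : ℝ) 1 ∩ R ⁻¹' {b})
    exact isClosed_Icc.inter (isClosed_singleton.preimage hR)
  have hTbdd : BddBelow T := ⟨0, fun u hu => (hTsub hu).1⟩
  have hjT : j ∈ T := hj ▸ hTcl.csInf_mem hTne hTbdd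
  refine ⟨hTsub hjT, ?_, ?_⟩
  · rcases hjT with h | h
    · exact Or.inr h
    · exact Or.inl h.2
  · intro u hu0 huj hRu
    have hu1 : u ≤ 1 := huj.le.trans (hTsub hjT).2
    have huT : u ∈ T := Or.inr ⟨⟨hu0, hu1⟩, hRu⟩
    have : j ≤ u := hj ▸ csInf_le hTbdd huT
    exact (lt_irrefl _) (huj.trans_le this)

omit [T1Space X] in
/-- **First entrance of a path into a closed set.** For `f` continuous on `[0,1]`, `M` closed,
`f 1 ∈ M`, `f 0 ∉ M` and `s₁ = sInf {s ∈ (0,1] | f s ∈ M}`: `0 < s₁ ≤ 1`, `f s₁ ∈ M`, and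
`f s ∉ M` for `0 < s < s₁`. -/
theorem firstEntrance_spec {f : ℝ → X} (hf : ContinuousOn f (Icc (0 : ℝ) 1)) {M : Set X}
    (hM : IsClosed M) (h1 : f 1 ∈ M) (h0 : f 0 ∉ M) {s₁ : ℝ}
    (hs : s₁ = sInf {s | s ∈ Ioc (0 : ℝ) 1 ∧ f s ∈ M}) :
    s₁ ∈ Ioc (0 : ℝ) 1 ∧ f s₁ ∈ M ∧ ∀ s, 0 < s → s < s₁ → f s ∉ M := by
  set S : Set ℝ := {s | s ∈ Ioc (0 : ℝ) 1 ∧ f s ∈ M} with hS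
  have hS' : S = Icc (0 : ℝ) 1 ∩ f ⁻¹' M := by
    ext s
    refine ⟨fun h => ⟨⟨h.1.1.le, h.1.2⟩, h.2⟩, fun h => ⟨⟨?_, h.1.2⟩, h.2⟩⟩
    rcases h.1.1.eq_or_lt with h0' | hpos
    · exact absurd (h0' ▸ h.2 : f 0 ∈ M) h0
    · exact hpos
  have hScl : IsClosed S := hS' ▸ hf.preimage_isClosed_of_isClosed isClosed_Icc hM
  have hSne : S.Nonempty := ⟨1, ⟨zero_lt_one, le_rfl⟩, h1⟩
  have hSbdd : BddBelow S := ⟨0, fun s h => h.1.1.le⟩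
  have hsS : s₁ ∈ S := hs ▸ hScl.csInf_mem hSne hSbdd
  refine ⟨hsS.1, hsS.2, ?_⟩
  intro s hs0 hss hfs
  have hs1 : s ≤ 1 := hss.le.trans hsS.1.2
  have : s₁ ≤ s := hs ▸ csInf_le hSbdd ⟨⟨hs0, hs1⟩, hfs⟩
  exact (lt_irrefl _) (hss.trans_le this)

omit [TopologicalSpace X] [T1Space X] in
/-- Degenerate first entrance: if the whole path `f((0,1])` lies in `M`, the entrance parameter
`sInf {s ∈ (0,1] | f s ∈ M}` is `0`. -/
theorem firstEntrance_eq_zero {f : ℝ → X} {M : Set X} (h : ∀ s ∈ Ioc (0 : ℝ) 1, f s ∈ M) :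
    sInf {s | s ∈ Ioc (0 : ℝ) 1 ∧ f s ∈ M} = 0 := by
  have : {s | s ∈ Ioc (0 : ℝ) 1 ∧ f s ∈ M} = Ioc (0 : ℝ) 1 := by
    ext s
    exact ⟨fun hs => hs.1, fun hs => ⟨hs, h s hs⟩⟩
  rw [this, csInf_Ioc zero_lt_one]

omit [T1Space X] in
/-- **Last exit of a ray from a closed set.** For `g` continuous on `[1, ∞)`, `M` closed,
`g 1 ∈ M`, `g ρ ∉ M` for all `ρ ≥ Rb`, and `r₁ = sSup ({1} ∪ {ρ ≥ 1 | g ρ ∈ M})`: `1 ≤ r₁`,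
`g r₁ ∈ M`, and `g ρ ∉ M` for `ρ > r₁`. -/
theorem lastExit_spec {g : ℝ → X} (hg : ContinuousOn g (Ici (1 : ℝ))) {M : Set X}
    (hM : IsClosed M) (h1 : g 1 ∈ M) {Rb : ℝ} (hfar : ∀ ρ, Rb ≤ ρ → g ρ ∉ M) {r₁ : ℝ}
    (hr : r₁ = sSup ({(1 : ℝ)} ∪ {ρ | 1 ≤ ρ ∧ g ρ ∈ M})) :
    1 ≤ r₁ ∧ g r₁ ∈ M ∧ ∀ ρ, r₁ < ρ → g ρ ∉ M := by
  set T : Set ℝ := {(1 : ℝ)} ∪ {ρ | 1 ≤ ρ ∧ g ρ ∈ M} with hT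
  have hTcl : IsClosed T := by
    refine isClosed_singleton.union ?_
    change IsClosed (Ici (1 : ℝ) ∩ g ⁻¹' M)
    exact hg.preimage_isClosed_of_isClosed isClosed_Ici hM
  have hTne : T.Nonempty := ⟨1, Or.inl rfl⟩
  have hTbdd : BddAbove T := by
    refine ⟨max Rb 1, ?_⟩
    rintro ρ (hρ | hρ)
    · rw [mem_singleton_iff] at hρ; subst hρ; exact le_max_right _ _
    · by_contra hlt
      push Not at hlt
      exact hfar ρ ((le_max_left _ _).trans hlt.le) hρ.2
  have hrT : r₁ ∈ T := hr ▸ hTcl.csSup_mem hTne hTbdd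
  have hr1 : 1 ≤ r₁ ∧ g r₁ ∈ M := by
    rcases hrT with h | h
    · rw [mem_singleton_iff] at h
      rw [h]; exact ⟨le_rfl, h1⟩
    · exact h
  refine ⟨hr1.1, hr1.2, ?_⟩
  intro ρ hρ hgρ
  have hρT : ρ ∈ T := Or.inr ⟨hr1.1.trans hρ.le, hgρ⟩
  have : ρ ≤ r₁ := hr ▸ le_csSup hTbdd hρT
  exact (lt_irrefl _) (hρ.trans_le this)

/-- **First hit of a point on `[i, j]`.** For `Z` continuous on `[i,j]`, a value `J` attained there,
and `u₁ = sInf {u ∈ [i,j] | Z u = J}`: `u₁ ∈ [i,j]`, `Z u₁ = J`, and `Z u ≠ J` for `i ≤ u < u₁`. -/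
theorem firstHit_spec {Z : ℝ → X} {i j : ℝ} (hZ : ContinuousOn Z (Icc i j)) {J : X}
    (hex : ∃ u ∈ Icc i j, Z u = J) {u₁ : ℝ} (hu : u₁ = sInf {u | u ∈ Icc i j ∧ Z u = J}) :
    u₁ ∈ Icc i j ∧ Z u₁ = J ∧ ∀ u, i ≤ u → u < u₁ → Z u ≠ J := by
  set U : Set ℝ := {u | u ∈ Icc i j ∧ Z u = J} with hU
  have hUcl : IsClosed U := by
    change IsClosed (Icc i j ∩ Z ⁻¹' {J})
    exact hZ.preimage_isClosed_of_isClosed isClosed_Icc isClosed_singleton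
  obtain ⟨u0, hu0, hZu0⟩ := hex
  have hUne : U.Nonempty := ⟨u0, hu0, hZu0⟩
  have hUbdd : BddBelow U := ⟨i, fun u h => h.1.1⟩
  have huU : u₁ ∈ U := hu ▸ hUcl.csInf_mem hUne hUbdd
  refine ⟨huU.1, huU.2, ?_⟩
  intro u hiu huu hZu
  have huj : u ≤ j := huu.le.trans huU.1.2
  have : u₁ ≤ u := hu ▸ csInf_le hUbdd ⟨⟨hiu, huj⟩, hZu⟩
  exact (lt_irrefl _) (huu.trans_le this)

/-- **Last hit of a point on `[i, j]`.** For `Z` continuous on `[i,j]`, a value `J` attained there,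
and `v₁ = sSup {u ∈ [i,j] | Z u = J}`: `v₁ ∈ [i,j]`, `Z v₁ = J`, and `Z u ≠ J` for `v₁ < u ≤ j`. -/
theorem lastHit_spec {Z : ℝ → X} {i j : ℝ} (hZ : ContinuousOn Z (Icc i j)) {J : X}
    (hex : ∃ u ∈ Icc i j, Z u = J) {v₁ : ℝ} (hv : v₁ = sSup {u | u ∈ Icc i j ∧ Z u = J}) :
    v₁ ∈ Icc i j ∧ Z v₁ = J ∧ ∀ u, v₁ < u → u ≤ j → Z u ≠ J := by
  set U : Set ℝ := {u | u ∈ Icc i j ∧ Z u = J} with hU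
  have hUcl : IsClosed U := by
    change IsClosed (Icc i j ∩ Z ⁻¹' {J})
    exact hZ.preimage_isClosed_of_isClosed isClosed_Icc isClosed_singleton
  obtain ⟨u0, hu0, hZu0⟩ := hex
  have hUne : U.Nonempty := ⟨u0, hu0, hZu0⟩
  have hUbdd : BddAbove U := ⟨j, fun u h => h.1.2⟩
  have hvU : v₁ ∈ U := hv ▸ hUcl.csSup_mem hUne hUbdd
  refine ⟨hvU.1, hvU.2, ?_⟩
  intro u hvu huj hZu
  have hiu : i ≤ u := hvU.1.1.trans hvu.le
  have : u ≤ v₁ := hv ▸ le_csSup hUbdd ⟨⟨hiu, huj⟩, hZu⟩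
  exact (lt_irrefl _) (hvu.trans_le this)

end Order

end Summit.CriticalPhenomena.SAWScalingLimit.Theorems.AttachNoReturn
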